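import Mathlib.Probability.Distributions.Gaussian.Fernique
import Mathlib.Analysis.Convex.Integral
import Mathlib.Analysis.SpecialFunctions.Pow.Real
import Summits.QuantumFields.YangMills.Theorems.SourcedPressureJensenSourcedPressureIncrementGaussFirstCumulant

/-!
# `SourcedPressureIncrement` (stmt-QuantumFields-22517), line `birth`: the Gaussian sourced increment is FINITE near
# `h = 0` and bounded BELOW by its exact linear term (Jensen tightness of `stub_gauss`)

Helper file for the deciding crux item stmt-QuantumFields-22517 (route `SourcedPressureJensen`; ideator skeleton
`bc/SourcedPressureIncrement_birth.lean`, stub `stub_gauss`).  With `γ = curvatureGaussianField 4 D`,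
`A_x = (λ/2)|Y(p₁₂ x)|² − (λ/2) D C(0)` and `H_B = Σ_{x ∈ B} A_x A_{x + n e₀}` (the source of `gaussIncrement`, any finite
`B ⊂ ℤ⁴`):

* `exists_integrable_exp_mul_sum_sq` — small exponential moments of finite quadratic forms of the Gaussian field of a
  positive semidefinite kernel: for every finite index set `I` there is `c > 0` with `E exp(c Σ_{i ∈ I} ω_i²) < ∞`
  (Mathlib's Fernique theorem `IsGaussian.exists_integrable_exp_sq` on the finite-dimensional marginal
  `gaussianFamilyOfKernel K I`, transported along `gaussianFieldOfKernel_map_restrict`);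
* `neg_mul_source_le` — the one-sided domination `−h H_B ≤ h · m · λ · Σ_{s ∈ I(B)} ω_s²` for `h, λ ≥ 0`
  (`−(S − m)(S' − m) ≤ m (S + S')` for `S, S' ≥ 0`), `I(B)` = the (plaquette, colour) indices touched by `B`;
* `gauss_increment_jensen` — hence there is `h₀ = h₀(D, λ, n, B) > 0` such that for `0 ≤ h ≤ h₀` the Boltzmann factor
  `exp(−h H_B)` is `γ`-integrable (so `log E_γ exp(−h H_B)` is an honest logarithm, not a junk value) and, by Jensen and
  the exact first cumulant `gauss_firstCumulant_sum`,
  `−h · |B| · (λ² D/2) · C(n)² ≤ log E_γ exp(−h H_B)`: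
  the linear term `−h σ C(n)²`, `σ = λ²D/2`, of `stub_gauss` is attained from below — `stub_gauss` is the statement that the
  remainder is `O(h²)` per site uniformly in `B = B_L` (plus straddling), nothing weaker would do.

Not uniform in `B` (Fernique's constant depends on the marginal); the volume-uniform exponential moment bound is part of
`stub_gauss` proper.  RECORD-label rung support; the Yang–Mills mass gap is NOT proved by anything here. [folklore]
-/

noncomputable section

open MeasureTheory ProbabilityTheory
open Literature.MathematicalPhysics.QuantumFieldTheory Literature.MathematicalPhysics.QuantumLattice

namespace Summit.QuantumFields.YangMills.Cruxes.SourcedPressureIncrement.Birth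

/-! ### Small exponential moments of finite quadratic forms (Fernique on a finite marginal) -/

section ExpMoment

variable {ι : Type} [DecidableEq ι] {K : ι → ι → ℝ}

/-- **Small exponential moments of finite quadratic forms.**  For the centred Gaussian field of a positive semidefinite
kernel and every finite set of indices `I` there is `c > 0` with `exp(c Σ_{i ∈ I} ω_i²)` integrable (Fernique's theorem
for the Gaussian marginal on `ℝ^I`, `Σ_{i∈I} x_i² ≤ |I| ‖x‖_∞²`). [folklore] -/
theorem exists_integrable_exp_mul_sum_sq (hK : IsPosSemidefKernel K) (I : Finset ι) :
    ∃ c : ℝ, 0 < c ∧ Integrable (fun ω : ι → ℝ => Real.exp (c * ∑ i ∈ I, ω i ^ 2)) (gaussianFieldOfKernel K) := by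
  obtain ⟨C, hC, hint⟩ := IsGaussian.exists_integrable_exp_sq (gaussianFamilyOfKernel K I)
  refine ⟨C / (I.card + 1), by positivity, ?_⟩
  have hg : Integrable (fun x : ↥I → ℝ => Real.exp (C / (I.card + 1) * ∑ i : ↥I, x i ^ 2))
      (gaussianFamilyOfKernel K I) := by
    refine hint.mono' ?_ (ae_of_all _ fun x => ?_)
    · exact (by fun_prop : Continuous fun x : ↥I → ℝ =>
        Real.exp (C / (I.card + 1) * ∑ i : ↥I, x i ^ 2)).aestronglyMeasurable
    · rw [Real.norm_eq_abs, abs_of_pos (Real.exp_pos _)]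
      refine Real.exp_le_exp.2 ?_
      have hsum : ∑ i : ↥I, x i ^ 2 ≤ (I.card : ℝ) * ‖x‖ ^ 2 := by
        calc ∑ i : ↥I, x i ^ 2 ≤ ∑ _i : ↥I, ‖x‖ ^ 2 := Finset.sum_le_sum fun i _ => by
                have hi : ‖x i‖ ≤ ‖x‖ := norm_le_pi_norm x i
                rw [Real.norm_eq_abs] at hi
                calc x i ^ 2 = |x i| ^ 2 := (sq_abs _).symm
                  _ ≤ ‖x‖ ^ 2 := pow_le_pow_left₀ (abs_nonneg _) hi 2
          _ = (I.card : ℝ) * ‖x‖ ^ 2 := by simp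
      have hfrac : (I.card : ℝ) / (I.card + 1) ≤ 1 := div_le_one_of_le₀ (by linarith) (by positivity)
      calc C / (I.card + 1) * ∑ i : ↥I, x i ^ 2
          ≤ C / (I.card + 1) * ((I.card : ℝ) * ‖x‖ ^ 2) := mul_le_mul_of_nonneg_left hsum (by positivity)
        _ = C * ‖x‖ ^ 2 * ((I.card : ℝ) / (I.card + 1)) := by ring
        _ ≤ C * ‖x‖ ^ 2 * 1 := mul_le_mul_of_nonneg_left hfrac (by positivity)
        _ = C * ‖x‖ ^ 2 := mul_one _
  rw [← gaussianFieldOfKernel_map_restrict hK I] at hg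
  have h2 := (integrable_map_measure hg.aestronglyMeasurable (Finset.measurable_restrict I).aemeasurable).1 hg
  refine h2.congr (ae_of_all _ fun ω => ?_)
  simp only [Function.comp_apply, Finset.restrict_def, Finset.sum_coe_sort (f := fun i => ω i ^ 2)]

end ExpMoment

/-! ### Domination of the Boltzmann factor and Jensen for the Gaussian sourced increment (`d = 4`) -/

section Jensen

open Literature.Probability.LatticeModels

/-- Pointwise one-sided bound: for `S, S' ≥ 0` and any `m`, `−(S − m)(S' − m) ≤ m (S + S')`
(`= −S S' − m² ≤ 0` after expansion). [folklore] -/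
theorem neg_centred_mul_centred_le {S S' : ℝ} (m : ℝ) (hS : 0 ≤ S) (hS' : 0 ≤ S') :
    -((S - m) * (S' - m)) ≤ m * (S + S') := by
  nlinarith [mul_nonneg hS hS', sq_nonneg m]

/-- The (plaquette, colour) indices touched by the source over `B`: the `(1,2)`-plaquettes at `x` and at `x + n e₀`,
`x ∈ B`, all colours. [folklore] -/
theorem sum_colourSq_le_sum_indices (D : ℕ) (n : ℕ) (B : Finset (Site 4)) (ω : ZdPlaquette 4 × Fin D → ℝ) :
    ∑ x ∈ B, ((∑ a : Fin D, ω (plaquette12 (d := 4) (by norm_num) x, a) ^ 2) +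
        ∑ a : Fin D, ω (plaquette12 (d := 4) (by norm_num) (x + Pi.single (0 : Fin 4) (n : ℤ)), a) ^ 2) ≤
      2 * ∑ s ∈ (B.image (plaquette12 (d := 4) (by norm_num)) ∪
            B.image (fun x => plaquette12 (d := 4) (by norm_num) (x + Pi.single (0 : Fin 4) (n : ℤ)))) ×ˢ
          (Finset.univ : Finset (Fin D)), ω s ^ 2 := by
  set P : Finset (ZdPlaquette 4) := B.image (plaquette12 (d := 4) (by norm_num)) ∪
      B.image (fun x => plaquette12 (d := 4) (by norm_num) (x + Pi.single (0 : Fin 4) (n : ℤ))) with hP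
  have hinj : Function.Injective (plaquette12 (d := 4) (by norm_num : 3 ≤ 4)) := fun x y hxy => by
    simpa [plaquette12] using congrArg Prod.fst hxy
  have hinj' : Function.Injective (fun x : Site 4 => plaquette12 (d := 4) (by norm_num) (x + Pi.single (0 : Fin 4) (n : ℤ))) :=
    fun x y hxy => by simpa [plaquette12] using congrArg Prod.fst hxy
  have hnn : ∀ p ∈ P, 0 ≤ ∑ a : Fin D, ω (p, a) ^ 2 := fun p _ => Finset.sum_nonneg fun a _ => sq_nonneg _
  have h1 : ∑ x ∈ B, ∑ a : Fin D, ω (plaquette12 (d := 4) (by norm_num) x, a) ^ 2 ≤ ∑ p ∈ P, ∑ a : Fin D, ω (p, a) ^ 2 := by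
    rw [← Finset.sum_image (f := fun p => ∑ a : Fin D, ω (p, a) ^ 2) (fun x _ y _ h => hinj h)]
    exact Finset.sum_le_sum_of_subset_of_nonneg (Finset.subset_union_left) fun p hp _ => hnn p hp
  have h2 : ∑ x ∈ B, ∑ a : Fin D, ω (plaquette12 (d := 4) (by norm_num) (x + Pi.single (0 : Fin 4) (n : ℤ)), a) ^ 2 ≤
      ∑ p ∈ P, ∑ a : Fin D, ω (p, a) ^ 2 := by
    rw [← Finset.sum_image (f := fun p => ∑ a : Fin D, ω (p, a) ^ 2) (fun x _ y _ h => hinj' h)]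
    exact Finset.sum_le_sum_of_subset_of_nonneg (Finset.subset_union_right) fun p hp _ => hnn p hp
  rw [Finset.sum_add_distrib, Finset.sum_product]
  linarith

/-- **Finite exponential moment and Jensen lower bound for the Gaussian sourced increment near `h = 0`.**  For every
colour number `D`, scale `λ ≥ 0`, separation `n` and finite `B ⊂ ℤ⁴` there is `h₀ > 0` such that for `0 ≤ h ≤ h₀` the
Boltzmann factor `exp(−h Σ_{x∈B} A_x A_{x+ne₀})` is `γ`-integrable and
`−h · |B| · (λ²D/2) · C(n)² ≤ log E_γ exp(−h Σ_{x∈B} A_x A_{x+ne₀})` (integrand of `gaussIncrement` verbatim; with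
`B = B_L` and after division by `|B_L|`: `gaussIncrement D λ h n L ≥ −h (λ²D/2) C(n)²`). [folklore] -/
theorem gauss_increment_jensen (D : ℕ) {lam : ℝ} (hlam : 0 ≤ lam) (n : ℕ) (B : Finset (Site 4)) :
    ∃ h₀ : ℝ, 0 < h₀ ∧ ∀ h : ℝ, 0 ≤ h → h ≤ h₀ →
      Integrable (fun Y : ZdPlaquette 4 → Fin D → ℝ => Real.exp (-h * ∑ x ∈ B,
          (lam / 2 * (∑ a : Fin D, (Y (plaquette12 (d := 4) (by norm_num) x) a) ^ 2) -
              lam / 2 * D * curvaturePlaquetteCorr (d := 4) (by norm_num) 0) *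
            (lam / 2 * (∑ a : Fin D, (Y (plaquette12 (d := 4) (by norm_num) (x + Pi.single (0 : Fin 4) (n : ℤ))) a) ^ 2) -
              lam / 2 * D * curvaturePlaquetteCorr (d := 4) (by norm_num) 0)))
        (curvatureGaussianField (d := 4) D) ∧
      -h * ((B.card : ℝ) * (lam ^ 2 * D / 2 * (curvaturePlaquetteCorr (d := 4) (by norm_num) (n : ℤ)) ^ 2)) ≤
        Real.log (∫ Y, Real.exp (-h * ∑ x ∈ B,
          (lam / 2 * (∑ a : Fin D, (Y (plaquette12 (d := 4) (by norm_num) x) a) ^ 2) -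
              lam / 2 * D * curvaturePlaquetteCorr (d := 4) (by norm_num) 0) *
            (lam / 2 * (∑ a : Fin D, (Y (plaquette12 (d := 4) (by norm_num) (x + Pi.single (0 : Fin 4) (n : ℤ))) a) ^ 2) -
              lam / 2 * D * curvaturePlaquetteCorr (d := 4) (by norm_num) 0))
          ∂curvatureGaussianField (d := 4) D) := by
  have hd : 3 ≤ 4 := by norm_num
  have hK := isPosSemidefKernel_curvatureCovKernel hd D
  haveI := isProbabilityMeasure_curvatureGaussianField hd D
  haveI := isProbabilityMeasure_gaussianFieldOfKernel hK
  -- abbreviations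
  set p : Site 4 → ZdPlaquette 4 := plaquette12 (d := 4) hd with hp
  set q : Site 4 → ZdPlaquette 4 := fun x => plaquette12 (d := 4) hd (x + Pi.single (0 : Fin 4) (n : ℤ)) with hq
  set m : ℝ := lam / 2 * D * curvaturePlaquetteCorr (d := 4) hd 0 with hm
  have hm0 : 0 ≤ m := by
    rw [hm, curvaturePlaquetteCorr_zero hd]
    positivity
  -- the touched indices and their small exponential moment
  set I : Finset (ZdPlaquette 4 × Fin D) := (B.image p ∪ B.image q) ×ˢ (Finset.univ : Finset (Fin D)) with hI
  obtain ⟨c, hc, hintc⟩ := exists_integrable_exp_mul_sum_sq hK I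
  refine ⟨c / (m * lam + 1), by positivity, fun h hh hhle => ?_⟩
  have hcoef : h * (m * lam) ≤ c := by
    have h1 : h * (m * lam) ≤ c / (m * lam + 1) * (m * lam) := mul_le_mul_of_nonneg_right hhle (by positivity)
    have h2 : c / (m * lam + 1) * (m * lam) ≤ c := by
      rw [div_mul_eq_mul_div, div_le_iff₀ (by positivity)]
      nlinarith
    linarith
  -- the source on the uncurried configuration space
  set Hω : (ZdPlaquette 4 × Fin D → ℝ) → ℝ := fun ω => ∑ x ∈ B,
      (lam / 2 * (∑ a : Fin D, ω (p x, a) ^ 2) - m) * (lam / 2 * (∑ a : Fin D, ω (q x, a) ^ 2) - m) with hHω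
  have hdom : ∀ ω, -h * Hω ω ≤ c * ∑ s ∈ I, ω s ^ 2 := by
    intro ω
    have hstep : -Hω ω ≤ m * (lam / 2) * ∑ x ∈ B, ((∑ a : Fin D, ω (p x, a) ^ 2) + ∑ a : Fin D, ω (q x, a) ^ 2) := by
      rw [hHω, ← Finset.sum_neg_distrib, Finset.mul_sum]
      refine Finset.sum_le_sum fun x _ => ?_
      have hS : 0 ≤ lam / 2 * ∑ a : Fin D, ω (p x, a) ^ 2 :=
        mul_nonneg (by positivity) (Finset.sum_nonneg fun a _ => sq_nonneg _)
      have hS' : 0 ≤ lam / 2 * ∑ a : Fin D, ω (q x, a) ^ 2 :=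
        mul_nonneg (by positivity) (Finset.sum_nonneg fun a _ => sq_nonneg _)
      have := neg_centred_mul_centred_le m hS hS'
      nlinarith [this]
    have hidx := sum_colourSq_le_sum_indices D n B ω
    have hnn : 0 ≤ ∑ s ∈ I, ω s ^ 2 := Finset.sum_nonneg fun s _ => sq_nonneg _
    have hsum_le : ∑ x ∈ B, ((∑ a : Fin D, ω (p x, a) ^ 2) + ∑ a : Fin D, ω (q x, a) ^ 2) ≤ 2 * ∑ s ∈ I, ω s ^ 2 := by
      simpa [hp, hq, hI] using hidx
    calc -h * Hω ω = h * (-Hω ω) := by ring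
      _ ≤ h * (m * (lam / 2) * (2 * ∑ s ∈ I, ω s ^ 2)) := by
          refine mul_le_mul_of_nonneg_left (hstep.trans ?_) hh
          exact mul_le_mul_of_nonneg_left hsum_le (by positivity)
      _ = h * (m * lam) * ∑ s ∈ I, ω s ^ 2 := by ring
      _ ≤ c * ∑ s ∈ I, ω s ^ 2 := mul_le_mul_of_nonneg_right hcoef hnn
  -- integrability of the Boltzmann factor on the uncurried side
  have hmeasH : Measurable Hω := by
    refine Continuous.measurable ?_
    rw [hHω]
    fun_prop
  have hintω : Integrable (fun ω => Real.exp (-h * Hω ω)) (gaussianFieldOfKernel (curvatureCovKernel 4 D)) := by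
    refine hintc.mono' ((Real.continuous_exp.measurable.comp (hmeasH.const_mul (-h))).aestronglyMeasurable)
      (ae_of_all _ fun ω => ?_)
    rw [Real.norm_eq_abs, abs_of_pos (Real.exp_pos _)]
    exact Real.exp_le_exp.2 (hdom ω)
  -- transport to the curvature field (currying)
  have hcomp : ((fun Y : ZdPlaquette 4 → Fin D → ℝ => Real.exp (-h * ∑ x ∈ B,
          (lam / 2 * (∑ a : Fin D, (Y (p x)) a ^ 2) - m) * (lam / 2 * (∑ a : Fin D, (Y (q x)) a ^ 2) - m))) ∘
        ⇑(MeasurableEquiv.curry (ZdPlaquette 4) (Fin D) ℝ)) = fun ω => Real.exp (-h * Hω ω) := by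
    funext ω
    simp only [Function.comp_apply, MeasurableEquiv.coe_curry, Function.curry_apply, hHω]
  have hintY : Integrable (fun Y : ZdPlaquette 4 → Fin D → ℝ => Real.exp (-h * ∑ x ∈ B,
      (lam / 2 * (∑ a : Fin D, (Y (p x)) a ^ 2) - m) * (lam / 2 * (∑ a : Fin D, (Y (q x)) a ^ 2) - m)))
      (curvatureGaussianField (d := 4) D) := by
    rw [curvatureGaussianField]
    refine (integrable_map_equiv _ _).2 ?_
    rw [hcomp]
    exact hintω
  refine ⟨hintY, ?_⟩
  -- Jensen: exp (∫ −hH) ≤ ∫ exp(−hH)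
  have hlin : Integrable (fun Y : ZdPlaquette 4 → Fin D → ℝ => -h * ∑ x ∈ B,
      (lam / 2 * (∑ a : Fin D, (Y (p x)) a ^ 2) - m) * (lam / 2 * (∑ a : Fin D, (Y (q x)) a ^ 2) - m))
      (curvatureGaussianField (d := 4) D) :=
    (integrable_finsetSum B fun x _ => integrable_gauss_summand D lam n x).const_mul (-h)
  have hJ := ConvexOn.map_integral_le (μ := curvatureGaussianField (d := 4) D) convexOn_exp
    Real.continuous_exp.continuousOn isClosed_univ (ae_of_all _ fun Y => Set.mem_univ _) hlin hintY
  have hfirst : ∫ Y, -h * ∑ x ∈ B,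
      (lam / 2 * (∑ a : Fin D, (Y (p x)) a ^ 2) - m) * (lam / 2 * (∑ a : Fin D, (Y (q x)) a ^ 2) - m)
      ∂curvatureGaussianField (d := 4) D =
      -h * ((B.card : ℝ) * (lam ^ 2 * D / 2 * (curvaturePlaquetteCorr (d := 4) hd (n : ℤ)) ^ 2)) := by
    rw [integral_const_mul, gauss_firstCumulant_sum D lam n B]
  rw [hfirst] at hJ
  have hpos : 0 < ∫ Y, Real.exp (-h * ∑ x ∈ B,
      (lam / 2 * (∑ a : Fin D, (Y (p x)) a ^ 2) - m) * (lam / 2 * (∑ a : Fin D, (Y (q x)) a ^ 2) - m))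
      ∂curvatureGaussianField (d := 4) D := lt_of_lt_of_le (Real.exp_pos _) hJ
  have hlog := Real.log_le_log (Real.exp_pos _) hJ
  rwa [Real.log_exp] at hlog

end Jensen

end Summit.QuantumFields.YangMills.Cruxes.SourcedPressureIncrement.Birth
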